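import Summits.MatrixMultiplication.MatrixMultiplication.Theorems.SnSubsetDichotomyGlobalBranchStubTruncatedCount
import Summits.MatrixMultiplication.MatrixMultiplication.Theorems.SnSubsetDichotomyGlobalBranchStubDimGrowth

/-!
# The flat case of `GlobalBranch` (crux stmt-MatrixMultiplication-8303, line flat-tail-truncation)

Crux `Summit.MatrixMultiplication.MatrixMultiplication.Theses.SnSubsetDichotomy.GlobalBranch`, line
`flat-tail-truncation`, stub `stub_flatCase`: **a TPP triple in `𝔖ₙ` all of whose three sets are
spectrally flat at every level `1 ≤ ℓ ≤ ⌊√n⌋` is sub-threshold**,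
`|S||T||U| ≤ (n!)^{3/2} e^{-c√n}` for an absolute `c > 0` and all large `n` — the level-`√n`
analogue of Blasiak–Cohn–Grochow–Pratt–Umans 2023, Thm 3.2 (`L = 0`, tree theorem
`BCGPU2023_thm32_holds`), with NO bump hypothesis.

Here the spectral level-`ℓ` row mass of `X ⊆ 𝔖ₙ` is
`sM ℓ X = |X|⁻² Σ_{μ ≠ (n), μ₁ = n-ℓ} Σ_{x,y ∈ X} Re χ^μ(x⁻¹y)` (the Hilbert–Schmidt mass of `1̂_X` on
the irreducibles `S^μ` with first row `n - ℓ`), `sT` is the column version (`μ₁' = n - ℓ`), both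
entering as function parameters pinned by their defining equations, and flatness at level `ℓ` is the
cube condition `n^{(ℓ)}·(sM ℓ X)³ ≤ 8^{-ℓ}` and `n^{(ℓ)}·(sT ℓ X)³ ≤ 8^{-ℓ}`.

Proof: the two-ended truncated count `stub_truncatedCount` at `L = ⌊√n⌋` with the dimension threshold
`D = e^{c'√n}` supplied by `stub_dimGrowth` (`c' = min c 4`), the geometric series
`Σ_ℓ n^{(ℓ)}(sM³ + sT³) ≤ 2 Σ_{ℓ≥1} 8^{-ℓ} = 2/7` on flat triples, and the real-variable lemma
`flatCase_arith_core` (`V² ≤ FV + FRV/E² + (2/7)V²`, `R ≥ 4E`, `E ≥ 3` ⇒ `VE ≤ FR`) with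
`F = n!`, `R = √(n!)`, `E = e^{c'√n/4}` (`16 e^{2√n} ≤ n!` for `n ≥ 8`).
-/

set_option linter.dupNamespace false

open scoped BigOperators Matrix ComplexOrder
open Finset
open Literature.Combinatorics.Additive (TripleProductProperty indicatorElem indicatorElemInv)
open Literature.NumberTheory.DiophantineGeometry (numStandardTableaux spechtCharacter)
open Literature.RepresentationTheory.FiniteGroups (BlockAlgebraC blockRep)

namespace Summit.MatrixMultiplication.MatrixMultiplication.Theorems.GlobalBranch

open Literature.RepresentationTheory.FiniteGroups Literature.Barriers.MatrixMultiplication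

section Arithmetic

/-- Every character sum `Σ_{x,y∈X} Re χ^μ(x⁻¹y)` of `𝔖ₙ` is non-negative (it is a Hilbert–Schmidt
norm in a unitary Wedderburn decomposition, `stub_blockDictionary`). [folklore] -/
theorem flatCase_charSum_nonneg {n : ℕ} (μ : Nat.Partition n) (X : Finset (Equiv.Perm (Fin n))) :
    0 ≤ ∑ x ∈ X, ∑ y ∈ X, (spechtCharacter ℂ μ (x⁻¹ * y)).re := by
  classical
  obtain ⟨r, d, hd, φ, hφ⟩ := exists_unitary_algEquiv_pi_matrix (Equiv.Perm (Fin n))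
  haveI : ∀ i, NeZero (d i) := hd
  obtain ⟨part, hbij, -, -, -, hnorm⟩ := stub_blockDictionary n φ hφ
  obtain ⟨i, rfl⟩ := hbij.2 μ
  rw [← hnorm i X]
  exact re_trace_conjTranspose_mul_self_nonneg _

/-- `N·abc ≤ B` from `N·a³, N·b³, N·c³ ≤ B` for non-negative reals (bound by the largest).
[folklore] -/
theorem flatCase_mul_prod3_le {N a b c B : ℝ} (hN : 0 ≤ N) (ha : 0 ≤ a) (hb : 0 ≤ b) (hc : 0 ≤ c)
    (hA : N * a ^ 3 ≤ B) (hB : N * b ^ 3 ≤ B) (hC : N * c ^ 3 ≤ B) : N * (a * b * c) ≤ B := by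
  have key : ∀ m : ℝ, a ≤ m → b ≤ m → c ≤ m → N * m ^ 3 ≤ B → N * (a * b * c) ≤ B := by
    intro m ham hbm hcm hm
    have hm0 : 0 ≤ m := ha.trans ham
    have h1 : a * b * c ≤ m ^ 3 := by
      calc a * b * c ≤ m * m * m :=
            mul_le_mul (mul_le_mul ham hbm hb hm0) hcm hc (mul_nonneg hm0 hm0)
        _ = m ^ 3 := by ring
    exact (mul_le_mul_of_nonneg_left h1 hN).trans hm
  rcases le_total a b with hab | hab <;> rcases le_total b c with hbc | hbc <;>
    rcases le_total a c with hac | hac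
  all_goals first
    | exact key c (by linarith) (by linarith) le_rfl hC
    | exact key b (by linarith) le_rfl (by linarith) hB
    | exact key a le_rfl (by linarith) (by linarith) hA

/-- `128 · 2ⁿ ≤ n!` for `n ≥ 8`. [folklore] -/
theorem flatCase_factorial_ge (n : ℕ) (hn : 8 ≤ n) : 128 * 2 ^ n ≤ n.factorial := by
  induction n, hn using Nat.le_induction with
  | base => decide
  | succ m hm ih =>
    rw [Nat.factorial_succ, pow_succ]
    calc 128 * (2 ^ m * 2) = 2 * (128 * 2 ^ m) := by ring
      _ ≤ (m + 1) * m.factorial := Nat.mul_le_mul (by omega) ih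

/-- `16 e^{2√n} ≤ n!` for `n ≥ 8`. [folklore] -/
theorem flatCase_sixteen_exp_le_factorial (n : ℕ) (hn : 8 ≤ n) :
    16 * Real.exp (Real.sqrt n) ^ 2 ≤ (n.factorial : ℝ) := by
  have hs0 : 0 ≤ Real.sqrt (n : ℝ) := Real.sqrt_nonneg _
  have hsq : Real.sqrt (n : ℝ) ^ 2 = n := Real.sq_sqrt (Nat.cast_nonneg n)
  have h2s : 2 * Real.sqrt (n : ℝ) ≤ 2 + (n : ℝ) / 2 := by
    nlinarith [sq_nonneg (Real.sqrt (n : ℝ) - 2)]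
  have he : Real.exp 1 < 2.7182818286 := Real.exp_one_lt_d9
  have he0 : 0 < Real.exp 1 := Real.exp_pos 1
  have hexp2 : Real.exp 2 ≤ 8 := by
    have h' : Real.exp 2 = Real.exp 1 ^ 2 := by rw [← Real.exp_nat_mul]; norm_num
    rw [h']; nlinarith
  have hhalf : Real.exp (1 / 2) ≤ 2 := by
    have h4 : Real.exp 1 ≤ 4 := by linarith
    rw [Real.exp_half 1]
    calc Real.sqrt (Real.exp 1) ≤ Real.sqrt 4 := Real.sqrt_le_sqrt h4
      _ = 2 := by rw [show (4 : ℝ) = 2 ^ 2 by norm_num, Real.sqrt_sq (by norm_num)]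
  have hexpn : Real.exp ((n : ℝ) / 2) ≤ 2 ^ n := by
    have h' : Real.exp ((n : ℝ) / 2) = Real.exp (1 / 2) ^ n := by
      rw [← Real.exp_nat_mul]; congr 1; ring
    rw [h']
    exact pow_le_pow_left₀ (Real.exp_pos _).le hhalf n
  have hfac : (128 : ℝ) * 2 ^ n ≤ (n.factorial : ℝ) := by exact_mod_cast flatCase_factorial_ge n hn
  calc 16 * Real.exp (Real.sqrt n) ^ 2 = 16 * Real.exp (2 * Real.sqrt n) := by
        rw [← Real.exp_nat_mul]; norm_num
    _ ≤ 16 * Real.exp (2 + (n : ℝ) / 2) := by gcongr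
    _ = 16 * (Real.exp 2 * Real.exp ((n : ℝ) / 2)) := by rw [Real.exp_add]
    _ ≤ 16 * (8 * 2 ^ n) := by gcongr
    _ = 128 * 2 ^ n := by ring
    _ ≤ _ := hfac

/-- The real-variable core of the flat-case arithmetic: from `V² ≤ F V + F R V / E² + V² Λ`,
`Λ ≤ 2/7`, `R ≥ 4E`, `E ≥ 3` conclude `V E ≤ F R`. [folklore] -/
theorem flatCase_arith_core {V Λ F E R : ℝ} (hV : 0 ≤ V) (hΛ : Λ ≤ 2 / 7) (hF0 : 0 < F)
    (hE3 : 3 ≤ E) (hR0 : 0 < R) (hRE : 4 * E ≤ R)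
    (h : V ^ 2 ≤ F * V + F * R * V / E ^ 2 + V ^ 2 * Λ) : V * E ≤ F * R := by
  have hE0 : 0 < E := by linarith
  have key : 7 * E ^ 2 + 7 * R ≤ 5 * R * E := by
    nlinarith [mul_nonneg (sub_nonneg.2 hRE) (by linarith : (0 : ℝ) ≤ 5 * E - 7),
      mul_nonneg hE0.le (by linarith : (0 : ℝ) ≤ 13 * E - 28)]
  rcases hV.eq_or_lt with hV0 | hVpos
  · rw [← hV0, zero_mul]; positivity
  · have hdiv : V ≤ F + F * R / E ^ 2 + V * Λ := by
      have h1 : V * V ≤ V * (F + F * R / E ^ 2 + V * Λ) := by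
        have hr : V * (F + F * R / E ^ 2 + V * Λ) = F * V + F * R * V / E ^ 2 + V ^ 2 * Λ := by
          ring
        rw [hr, ← sq]; exact h
      exact le_of_mul_le_mul_left h1 hVpos
    have h57 : 5 / 7 * V ≤ F + F * R / E ^ 2 := by
      nlinarith [mul_le_mul_of_nonneg_left hΛ hV]
    have hE2 : 0 < E ^ 2 := by positivity
    have h57' : 5 / 7 * V * E ^ 2 ≤ F * E ^ 2 + F * R := by
      have h2 := mul_le_mul_of_nonneg_right h57 hE2.le
      rwa [add_mul, div_mul_cancel₀ _ hE2.ne'] at h2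
    have hkeyF : F * E ^ 2 + F * R ≤ 5 / 7 * (F * R * E) := by
      nlinarith [mul_le_mul_of_nonneg_left key hF0.le]
    have h3 : 5 / 7 * V * E ^ 2 ≤ 5 / 7 * (F * R * E) := h57'.trans hkeyF
    have h4 : (V * E) * (5 / 7 * E) ≤ (F * R) * (5 / 7 * E) := by nlinarith [h3]
    exact le_of_mul_le_mul_right h4 (by positivity)

end Arithmetic

/-- **The flat case of `GlobalBranch`** (stub `stub_flatCase` of the line `flat-tail-truncation`):
for some absolute `c > 0` and all large `n`, every triple `S, T, U ⊆ 𝔖ₙ` with the triple product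
property all of whose sets are spectrally flat at every level `1 ≤ ℓ ≤ ⌊√n⌋` —
`n^{(ℓ)}·(sM ℓ X)³ ≤ 8^{-ℓ}` and `n^{(ℓ)}·(sT ℓ X)³ ≤ 8^{-ℓ}`, where `sM ℓ X` (`sT ℓ X`) is the
Hilbert–Schmidt mass `|X|⁻² Σ_μ Σ_{x,y∈X} Re χ^μ(x⁻¹y)` of `1̂_X` on the irreducibles with first row
(first column) `n - ℓ` — satisfies `|S||T||U| ≤ (n!)^{3/2} e^{-c√n}`. -/
theorem stub_flatCase :
    ∃ c : ℝ, 0 < c ∧ ∃ n₃ : ℕ, ∀ n ≥ n₃,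
      ∀ (sM sT : ℕ → Finset (Equiv.Perm (Fin n)) → ℝ),
      (∀ (ℓ : ℕ) (X : Finset (Equiv.Perm (Fin n))), sM ℓ X =
        (∑ μ ∈ univ.filter (fun μ : Nat.Partition n =>
            μ ≠ Nat.Partition.indiscrete n ∧ μ.parts.sup = n - ℓ),
          ∑ x ∈ X, ∑ y ∈ X, (spechtCharacter ℂ μ (x⁻¹ * y)).re) / ((X.card : ℝ) ^ 2)) →
      (∀ (ℓ : ℕ) (X : Finset (Equiv.Perm (Fin n))), sT ℓ X =
        (∑ μ ∈ univ.filter (fun μ : Nat.Partition n =>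
            μ ≠ Nat.Partition.indiscrete n ∧ Multiset.card μ.parts = n - ℓ),
          ∑ x ∈ X, ∑ y ∈ X, (spechtCharacter ℂ μ (x⁻¹ * y)).re) / ((X.card : ℝ) ^ 2)) →
      ∀ S T U : Finset (Equiv.Perm (Fin n)), TripleProductProperty S T U →
      (∀ X : Finset (Equiv.Perm (Fin n)), (X = S ∨ X = T ∨ X = U) →
        ∀ ℓ : ℕ, 1 ≤ ℓ → ℓ ≤ Nat.sqrt n →
          (n.descFactorial ℓ : ℝ) * sM ℓ X ^ 3 ≤ (1 / 8 : ℝ) ^ ℓ ∧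
            (n.descFactorial ℓ : ℝ) * sT ℓ X ^ 3 ≤ (1 / 8 : ℝ) ^ ℓ) →
      ((S.card * T.card * U.card : ℕ) : ℝ) ≤
        (n.factorial : ℝ) ^ ((3 : ℝ) / 2) * Real.exp (-(c * Real.sqrt (n : ℝ))) := by
  obtain ⟨c, hc, n₁, hdim⟩ := stub_dimGrowth
  -- work with c' = min c 4
  set c' : ℝ := min c 4 with hc'
  have hc'0 : 0 < c' := lt_min hc (by norm_num)
  have hc'c : c' ≤ c := min_le_left _ _
  have hc'4 : c' ≤ 4 := min_le_right _ _
  -- N with √n ≥ 8/c' for n ≥ N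
  obtain ⟨N, hN⟩ := exists_nat_gt ((8 / c') ^ 2)
  refine ⟨c' / 4, by positivity, max n₁ (max 8 N), ?_⟩
  intro n hn sM sT hsM hsT S T U hTPP hflat
  have hn₁ : n₁ ≤ n := le_trans (le_max_left _ _) hn
  have hn8 : 8 ≤ n := le_trans (le_trans (le_max_left _ _) (le_max_right _ _)) hn
  have hnN : N ≤ n := le_trans (le_trans (le_max_right _ _) (le_max_right _ _)) hn
  have hn1 : 1 ≤ n := le_trans (by norm_num) hn8
  -- non-negativity of the masses
  have hsM_nonneg : ∀ ℓ X, 0 ≤ sM ℓ X := fun ℓ X => by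
    rw [hsM]
    exact div_nonneg (Finset.sum_nonneg fun μ _ => flatCase_charSum_nonneg μ X) (by positivity)
  have hsT_nonneg : ∀ ℓ X, 0 ≤ sT ℓ X := fun ℓ X => by
    rw [hsT]
    exact div_nonneg (Finset.sum_nonneg fun μ _ => flatCase_charSum_nonneg μ X) (by positivity)
  -- the low weight of a flat triple is ≤ 2/7
  set Λ : ℝ := ∑ ℓ ∈ Finset.Ico 1 (Nat.sqrt n + 1), (n.descFactorial ℓ : ℝ) *
    (sM ℓ S * sM ℓ T * sM ℓ U + sT ℓ S * sT ℓ T * sT ℓ U) with hΛdef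
  have hΛ : Λ ≤ 2 / 7 := by
    have hterm : ∀ ℓ ∈ Finset.Ico 1 (Nat.sqrt n + 1), (n.descFactorial ℓ : ℝ) *
        (sM ℓ S * sM ℓ T * sM ℓ U + sT ℓ S * sT ℓ T * sT ℓ U) ≤ 2 * (1 / 8 : ℝ) ^ ℓ := by
      intro ℓ hℓ
      rw [Finset.mem_Ico] at hℓ
      have h1 : 1 ≤ ℓ := hℓ.1
      have h2 : ℓ ≤ Nat.sqrt n := Nat.lt_succ_iff.mp hℓ.2
      obtain ⟨hS1, hS2⟩ := hflat S (Or.inl rfl) ℓ h1 h2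
      obtain ⟨hT1, hT2⟩ := hflat T (Or.inr (Or.inl rfl)) ℓ h1 h2
      obtain ⟨hU1, hU2⟩ := hflat U (Or.inr (Or.inr rfl)) ℓ h1 h2
      have hN : (0 : ℝ) ≤ (n.descFactorial ℓ : ℝ) := Nat.cast_nonneg _
      have hA := flatCase_mul_prod3_le hN (hsM_nonneg ℓ S) (hsM_nonneg ℓ T) (hsM_nonneg ℓ U)
        hS1 hT1 hU1
      have hB := flatCase_mul_prod3_le hN (hsT_nonneg ℓ S) (hsT_nonneg ℓ T) (hsT_nonneg ℓ U)
        hS2 hT2 hU2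
      rw [mul_add]; linarith
    calc Λ ≤ ∑ ℓ ∈ Finset.Ico 1 (Nat.sqrt n + 1), 2 * (1 / 8 : ℝ) ^ ℓ := Finset.sum_le_sum hterm
      _ = 2 * ∑ ℓ ∈ Finset.Ico 1 (Nat.sqrt n + 1), (1 / 8 : ℝ) ^ ℓ := by rw [Finset.mul_sum]
      _ ≤ 2 * ((1 / 8 : ℝ) ^ 1 / (1 - 1 / 8)) := by
          gcongr
          exact geom_sum_Ico_le_of_lt_one (by norm_num) (by norm_num)
      _ = 2 / 7 := by norm_num
  -- the square root of n is large
  have hsqrt : 8 / c' ≤ Real.sqrt (n : ℝ) := by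
    rw [Real.le_sqrt (by positivity) (by positivity)]
    have : ((8 / c') ^ 2 : ℝ) ≤ N := hN.le
    exact this.trans (by exact_mod_cast hnN)
  set s : ℝ := Real.sqrt (n : ℝ) with hs
  have hs0 : 0 ≤ s := Real.sqrt_nonneg _
  -- D and E
  set D : ℝ := Real.exp (c' * s) with hDdef
  set E : ℝ := Real.exp (c' * s / 4) with hEdef
  have hD0 : 0 < D := Real.exp_pos _
  have hE0 : 0 < E := Real.exp_pos _
  have hE3 : 3 ≤ E := by
    have h2 : 2 ≤ c' * s / 4 := by
      have := mul_le_mul_of_nonneg_left hsqrt hc'0.le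
      rw [mul_div_cancel₀ _ hc'0.ne'] at this
      linarith
    have := Real.add_one_le_exp (c' * s / 4)
    rw [hEdef]; linarith
  have hsqrtD : Real.sqrt D = E ^ 2 := by
    rw [hDdef, hEdef, ← Real.exp_nat_mul, Real.sqrt_eq_rpow, ← Real.exp_mul]
    congr 1; push_cast; ring
  -- dimension hypothesis at threshold D
  have hdimD : ∀ μ : Nat.Partition n, Nat.sqrt n < n - max μ.parts.sup (Multiset.card μ.parts) →
      D ≤ (numStandardTableaux μ : ℝ) := by
    intro μ hμ
    refine le_trans ?_ (hdim n hn₁ μ hμ)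
    rw [hDdef]
    exact Real.exp_le_exp.2 (mul_le_mul_of_nonneg_right hc'c hs0)
  have hcount := stub_truncatedCount n (Nat.sqrt n) hn1 D hD0 hdimD sM sT hsM hsT S T U hTPP
  -- arithmetic
  have hF0 : (0 : ℝ) < n.factorial := by exact_mod_cast n.factorial_pos
  set F : ℝ := (n.factorial : ℝ) with hFdef
  set R : ℝ := Real.sqrt F with hRdef
  have hR0 : 0 < R := Real.sqrt_pos.2 hF0
  have h32 : F ^ ((3 : ℝ) / 2) = F * R := by
    rw [show (3 : ℝ) / 2 = 1 + 1 / 2 by norm_num, Real.rpow_add hF0, Real.rpow_one, hRdef,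
      Real.sqrt_eq_rpow]
  -- 4E ≤ R: 16 E² = 16 e^{c' s/2} ≤ 16 e^{2 s} ≤ n!
  have hRE : 4 * E ≤ R := by
    have hE2 : E ^ 2 ≤ Real.exp s ^ 2 := by
      rw [hEdef, ← Real.exp_nat_mul, ← Real.exp_nat_mul, Real.exp_le_exp]
      push_cast
      nlinarith [mul_le_mul_of_nonneg_right hc'4 hs0]
    have h16 : 16 * E ^ 2 ≤ F :=
      le_trans (by nlinarith [hE2]) (flatCase_sixteen_exp_le_factorial n hn8)
    rw [hRdef, Real.le_sqrt (by positivity) hF0.le]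
    nlinarith [h16]
  have hV : (0 : ℝ) ≤ ((S.card * T.card * U.card : ℕ) : ℝ) := Nat.cast_nonneg _
  rw [h32, hsqrtD] at hcount
  have hmain := flatCase_arith_core hV hΛ hF0 hE3 hR0 hRE hcount
  -- V ≤ F R / E = F^{3/2} e^{-(c'/4) s}
  rw [h32, show -(c' / 4 * s) = -(c' * s / 4) by ring, Real.exp_neg, ← hEdef, ← div_eq_mul_inv,
    le_div_iff₀ hE0]
  exact hmain

end Summit.MatrixMultiplication.MatrixMultiplication.Theorems.GlobalBranch
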